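import Literature.Geometry.PolyhedralFans.SectionMonoidTight
import Literature.AlgebraicGeometry.Resolution.LogBlowupChart
import Literature.AlgebraicGeometry.Resolution.LogRefinedChartUnits
import Literature.AlgebraicGeometry.Resolution.SharpMonoidEmbedding
import Literature.Analysis.Convex.FarkasMinkowskiWeyl
import Literature.Analysis.Convex.MinkowskiWeylPointedCone
import HarnessLib

/-!
# The monoid ideal of a regular projective subdivision: orthant-like blow-up charts — Kato (10.4)

`Literature/AlgebraicGeometry/Resolution/LogBlowupOrthant.lean`. The combinatorial half of the
one-chart case of K. Kato, *Toric singularities*, Amer. J. Math. 116 (1994), (10.4) ("Take a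
subdivision `F'` of `F(X)` … such that `M_{F',x} ≅ ℕ^{r(x)}` (9.8) … `(X', M') = (X, M) ×_F F'`")
in the un-normalised blow-up form: for an fs monoid `P ⊆ ℤⁿ` (finitely generated, saturated,
spanning) there is a finite `s ⊆ P` (the degree-`k` piece of the section monoid of a strictly
convex integral support function on a regular refinement of the face fan of `σ = P^∨`, `k` a
Veronese degree — [KKMS] I §2 Thm. 11 via `Fan.exists_regular_refinement_isStrictSupport`) such
that **every blow-up chart monoid `P⟨(s − a)⟩`, `a ∈ s`, is `ℕ^I ⊕ ℤ^{Iᶜ}` in a `ℤ`-basis of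
`ℤⁿ`** (`LogRefinedChart.IsOrthantLike`): `exists_finset_isOrthantLike_blowupChartMonoid`.

* `dualCone P` — `σ = P^∨ ⊆ ℚⁿ`, finitely generated (Minkowski–Weyl) and salient;
* `pieceZero_eq` — `Γ₀ = P` (saturation, Farkas for monoids);
* `exists_finset_isOrthantLike_blowupChartMonoid` — the theorem.

References: [Kato1994] (9.8), (10.3), (10.4); [KempfEtAl1973] Ch. I §2 Thm. 11;
[Fulton1993Toric] §1.2–§2.6.
-/

noncomputable section

namespace Literature.AlgebraicGeometry.Resolution

namespace LogBlowup

open PointedCone Literature.Geometry.PolyhedralFans Literature.Combinatorics.Optimization.HilbertBasis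
  LogRefinedChart

universe u

variable {n : ℕ} (P : AddSubmonoid (Fin n → ℤ))

/-! ### The dual cone `σ = P^∨` -/

/-- **The dual cone** `σ = P^∨ = {v ∈ ℚⁿ : ⟨p, v⟩ ≥ 0 for all p ∈ P}`. [cite: Kato1994, (9.6)] -/
def dualCone : PointedCone ℚ (Fin n → ℚ) where
  carrier := {v | ∀ p ∈ P, 0 ≤ toRat p ⬝ᵥ v}
  zero_mem' := fun p _ => by simp
  add_mem' := by
    intro a b ha hb p hp
    rw [dotProduct_add]
    exact add_nonneg (ha p hp) (hb p hp)
  smul_mem' := by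
    intro c v hv p hp
    rw [show (c • v : Fin n → ℚ) = (c : ℚ) • v from rfl, dotProduct_smul, smul_eq_mul]
    exact mul_nonneg c.2 (hv p hp)

/-- Membership in the dual cone. [cite: Kato1994, (9.6)] -/
theorem mem_dualCone_iff {v : Fin n → ℚ} : v ∈ dualCone P ↔ ∀ p ∈ P, 0 ≤ toRat p ⬝ᵥ v := Iff.rfl

/-- Membership is tested on generators of `P`. [cite: Kato1994, (9.6)] -/
theorem mem_dualCone_iff_gens {T : Finset (Fin n → ℤ)} (hT : AddSubmonoid.closure (T : Set (Fin n → ℤ)) = P)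
    {v : Fin n → ℚ} : v ∈ dualCone P ↔ ∀ t ∈ T, 0 ≤ toRat t ⬝ᵥ v := by
  constructor
  · intro hv t ht
    exact hv t (by rw [← hT]; exact AddSubmonoid.subset_closure ht)
  · intro hv p hp
    rw [← hT] at hp
    induction hp using AddSubmonoid.closure_induction with
    | mem x hx => exact hv x hx
    | zero => simp [toRat_zero]
    | add x y _ _ hx hy => rw [toRat_add, add_dotProduct]; exact add_nonneg hx hy

/-- **`P^∨` is finitely generated** (Minkowski–Weyl). [cite: Fulton1993Toric, §1.2 (1) p. 11] -/
theorem dualCone_fg (hP : P.FG) : (dualCone P).FG := by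
  classical
  obtain ⟨T, hT⟩ := hP
  let a : Fin T.card → (Fin n → ℚ) := fun i => -toRat ((T.equivFin.symm i : T) : Fin n → ℤ)
  obtain ⟨N, g, hg⟩ :=
    Literature.Analysis.Convex.FarkasMinkowskiWeyl.exists_generators_of_cone_le (𝕜 := ℚ) T.card a
  refine ⟨Finset.univ.image g, ?_⟩
  ext v
  rw [Finset.coe_image, Finset.coe_univ, Set.image_univ]
  change v ∈ PointedCone.hull ℚ (Set.range g) ↔ v ∈ dualCone P
  rw [Literature.Analysis.Convex.FarkasMinkowskiWeyl.mem_hull_range_iff_exists_nonneg, ← hg v,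
    mem_dualCone_iff_gens P hT]
  constructor
  · intro h t ht
    have := h (T.equivFin ⟨t, ht⟩)
    simp only [a, Equiv.symm_apply_apply, neg_dotProduct, neg_nonpos] at this
    exact this
  · intro h i
    simp only [a, neg_dotProduct, neg_nonpos]
    exact h _ (T.equivFin.symm i).2

/-- **`P^∨` is salient** when `P` spans `ℤⁿ`. [cite: Fulton1993Toric, §1.2 (13) p. 14] -/
theorem isSalient_dualCone (hspan : Submodule.span ℤ (P : Set (Fin n → ℤ)) = ⊤) :
    IsSalient (dualCone P) := by
  intro v hv hnv
  -- `⟨p, v⟩ = 0` for all `p ∈ P`, hence for all `p ∈ ℤⁿ`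
  have h0 : ∀ p ∈ P, toRat p ⬝ᵥ v = 0 := fun p hp =>
    le_antisymm (by have := hnv p hp; rw [dotProduct_neg] at this; linarith) (hv p hp)
  have h1 : ∀ p : Fin n → ℤ, toRat p ⬝ᵥ v = 0 := by
    intro p
    have hp : p ∈ Submodule.span ℤ (P : Set (Fin n → ℤ)) := by rw [hspan]; exact Submodule.mem_top
    induction hp using Submodule.span_induction with
    | mem x hx => exact h0 x hx
    | zero => simp [toRat_zero]
    | add x y _ _ hx hy => rw [toRat_add, add_dotProduct, hx, hy, add_zero]
    | smul c x _ hx =>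
      have : toRat (c • x) = (c : ℚ) • toRat x := by ext i; simp [toRat]
      rw [this, smul_dotProduct, hx, smul_zero]
  ext i
  have := h1 (Pi.single i 1)
  have e : toRat (Pi.single i (1 : ℤ)) = Pi.single i (1 : ℚ) := by
    ext j; by_cases h : j = i <;> simp [toRat, h]
  rw [e, single_dotProduct, one_mul] at this
  simpa using this

/-! ### `Γ₀ = P` -/

/-- The degree-zero piece of the section monoid of any data on a fan with support `σ = P^∨` is
`{u : ⟨u, v⟩ ≥ 0 on σ}`, which is `P` when `P` is saturated (Farkas for monoids; Kato (1.1) "fs").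
[cite: Fulton1993Toric, §1.2 Prop. 1 p. 12] -/
theorem mem_of_forall_dualCone (hP : P.FG)
    (hsat : ∀ (v : Fin n → ℤ) (k : ℕ), 0 < k → k • v ∈ P → v ∈ P) {u : Fin n → ℤ}
    (hu : ∀ v ∈ dualCone P, 0 ≤ toRat u ⬝ᵥ v) : u ∈ P := by
  classical
  obtain ⟨T, hT⟩ := hP
  let w : Fin T.card → (Fin n → ℤ) := fun i => ((T.equivFin.symm i : T) : Fin n → ℤ)
  have hrange : AddSubmonoid.closure (Set.range w) = P := by
    rw [← hT]; congr 1; ext x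
    constructor
    · rintro ⟨i, rfl⟩; exact (T.equivFin.symm i).2
    · intro hx; exact ⟨T.equivFin ⟨x, hx⟩, by simp [w]⟩
  have key : ∀ u' ∈ LogChart.dualInt w, 0 ≤ u' ⬝ᵥ u := by
    intro u' hu'
    have hmem : toRat u' ∈ dualCone P := by
      rw [mem_dualCone_iff_gens P hT]
      intro t ht
      have := hu' (T.equivFin ⟨t, ht⟩)
      simp only [w, Equiv.symm_apply_apply] at this
      rw [dotProduct_comm]
      have e : toRat u' ⬝ᵥ toRat t = ((u' ⬝ᵥ t : ℤ) : ℚ) := by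
        simp [dotProduct, toRat]
      rw [e]; exact_mod_cast this
    have h1 := hu _ hmem
    have e : toRat u ⬝ᵥ toRat u' = ((u ⬝ᵥ u' : ℤ) : ℚ) := by simp [dotProduct, toRat]
    rw [e] at h1
    rw [dotProduct_comm]
    exact_mod_cast h1
  obtain ⟨N, hN, hNu⟩ := LogChart.exists_nsmul_mem_of_forall_dotProduct_nonneg w key
  rw [hrange] at hNu
  exact hsat u N hN hNu

/-! ### The theorem -/

/-- **Orthant-like blow-up charts.** For a finitely generated, saturated, spanning `P ⊆ ℤⁿ` there
is a finite non-empty `s ⊆ P` such that for every `a ∈ s` the chart monoid `P⟨s − a⟩` of the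
blow-up of the monoid ideal generated by `s` is `ℕ^I ⊕ ℤ^{Iᶜ}` in some `ℤ`-basis of `ℤⁿ` (the
dual monoid of a regular cone of a regular projective subdivision of `P^∨`, [KKMS] I Thm. 11;
Kato (9.8), (10.4)). [cite: Kato1994, (10.4)] [cite: KempfEtAl1973, Ch. I §2 Thm. 11] -/
theorem exists_finset_isOrthantLike_blowupChartMonoid (hP : P.FG)
    (hsat : ∀ (v : Fin n → ℤ) (k : ℕ), 0 < k → k • v ∈ P → v ∈ P)
    (hspan : Submodule.span ℤ (P : Set (Fin n → ℤ)) = ⊤) :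
    ∃ s : Finset P, s.Nonempty ∧ ∀ a ∈ s,
      ∃ (b : Module.Basis (Fin n) ℤ (Fin n → ℤ)) (I : Finset (Fin n)),
        IsOrthantLike b I (LogChart.blowupChartMonoid P (↑s : Set P) a) := by
  classical
  -- the regular refinement with a strictly convex integral support function
  set σ := dualCone P with hσ
  have hfg := dualCone_fg P hP
  have hsal := isSalient_dualCone P hspan
  obtain ⟨l, -, href, hreg, -, m, hm, hint, hnn⟩ :=
    Fan.exists_regular_refinement_isStrictSupport (κ := Fin n) σ hfg hsal
  set Δ := (Fan.ofCone σ hfg hsal).starIter l with hΔ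
  have hsupp : Δ.support = (σ : Set (Fin n → ℚ)) := by rw [href.support_eq, Fan.support_ofCone]
  have hadd : ∀ x ∈ Δ.support, ∀ y ∈ Δ.support, x + y ∈ Δ.support := by
    intro x hx y hy; rw [hsupp] at *; exact σ.add_mem hx hy
  have hne : Δ.cones.Nonempty := by
    have : (0 : Fin n → ℚ) ∈ Δ.support := by rw [hsupp]; exact σ.zero_mem
    obtain ⟨ρ, hρ, -⟩ := Fan.mem_support.1 this
    exact ⟨ρ, hρ⟩
  -- generators of the cones
  let gens : PointedCone ℚ (Fin n → ℚ) → Finset (Fin n → ℚ) := fun ρ =>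
    if h : ρ ∈ Δ.cones then (Δ.fg h).choose else ∅
  have hgens : ∀ ρ ∈ Δ.cones, PointedCone.hull ℚ (gens ρ : Set (Fin n → ℚ)) = ρ := by
    intro ρ hρ; simp only [gens, dif_pos hρ]; exact (Δ.fg hρ).choose_spec
  -- `Γ₀ = P`
  have hP0 : (pieceZero Δ m : Set (Fin n → ℤ)) = P := by
    ext u
    rw [SetLike.mem_coe, mem_pieceZero_iff, SetLike.mem_coe]
    constructor
    · intro hu
      refine mem_of_forall_dualCone P hP hsat fun v hv => ?_
      have hv' : v ∈ Δ.support := by rw [hsupp]; exact hv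
      obtain ⟨ρ, hρ, hvρ⟩ := Fan.mem_support.1 hv'
      exact hu ρ hρ v hvρ
    · intro hu ρ hρ v hvρ
      have hv : v ∈ σ := by
        have : v ∈ Δ.support := Fan.mem_support.2 ⟨ρ, hρ, hvρ⟩
        rwa [hsupp] at this
      exact hv u hu
  -- pieces lie in `P` (as `m ≥ 0` on `σ`)
  have hpieceP : ∀ k, piece Δ m k ⊆ P := by
    intro k u hu
    have goal : u ∈ (P : Set (Fin n → ℤ)) := by
      rw [← hP0, SetLike.mem_coe, mem_pieceZero_iff]
      intro ρ hρ v hvρ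
      have h1 := (mem_secMonoid_iff Δ m).1 hu ρ hρ v hvρ
      rw [sub_dotProduct, smul_dotProduct, smul_eq_mul, sub_nonneg] at h1
      have hv : v ∈ σ := by
        have : v ∈ Δ.support := Fan.mem_support.2 ⟨ρ, hρ, hvρ⟩
        rwa [hsupp] at this
      exact le_trans (mul_nonneg (Nat.cast_nonneg k) (hnn ρ hρ v hv)) h1
    exact goal
  -- Veronese degree and generators of `Γ_k`
  obtain ⟨k, hk, hver⟩ := exists_veronese Δ m
  obtain ⟨s₀, hs₀k, hs₀gen⟩ := exists_piece_generators Δ m k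
  -- `Γ_k ≠ ∅`: `k • m ρ ∈ Γ_k`
  obtain ⟨ρ₁, hρ₁⟩ := hne
  obtain ⟨u₁, hu₁⟩ : ∃ u₁ : Fin n → ℤ, toRat u₁ = m ρ₁ := by
    choose f hf using hint ρ₁ hρ₁
    exact ⟨fun i => f i, funext fun i => (hf i).symm⟩
  have hku₁ : k • u₁ ∈ piece Δ m k := by
    rw [mem_piece_iff, mem_secMonoid_iff]
    intro ρ hρ v hv
    simp only
    rw [toRat_nsmul, hu₁, ← smul_sub, smul_dotProduct, smul_eq_mul, sub_dotProduct]
    exact mul_nonneg (Nat.cast_nonneg k) (sub_nonneg.2 (hm hρ₁ hρ hv).1)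
  have hs₀ne : s₀.Nonempty := by
    obtain ⟨y, hy, -⟩ := hs₀gen _ hku₁
    exact ⟨y, hy⟩
  -- the finite set `s ⊆ P`
  let s : Finset P := s₀.attach.image fun y : ↥s₀ => (⟨(y : Fin n → ℤ), hpieceP k (hs₀k y.2)⟩ : P)
  have hs_coe : ∀ a : P, a ∈ s ↔ (a : Fin n → ℤ) ∈ s₀ := by
    intro a
    constructor
    · intro h
      obtain ⟨y, -, hy⟩ := Finset.mem_image.1 h
      rw [← hy]; exact y.2
    · intro h
      exact Finset.mem_image.2 ⟨⟨(a : Fin n → ℤ), h⟩, Finset.mem_attach _ _, Subtype.ext rfl⟩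
  refine ⟨s, ?_, fun a ha => ?_⟩
  · obtain ⟨y, hy⟩ := hs₀ne
    exact ⟨⟨y, hpieceP k (hs₀k hy)⟩, (hs_coe _).2 hy⟩
  -- the chart at `a`
  have ha₀ : (a : Fin n → ℤ) ∈ s₀ := (hs_coe a).1 ha
  obtain ⟨τ, hτ, htight⟩ := exists_tight_cone Δ m gens hgens hm hadd ⟨ρ₁, hρ₁⟩ hk (hs₀k ha₀)
  have hclos := closure_eq_setOf_exists Δ m hver hs₀k hs₀gen ha₀
  -- the chart monoid is `τ^∨ ∩ ℤⁿ`
  have hchart : ∀ x : Fin n → ℤ, x ∈ LogChart.blowupChartMonoid P (↑s : Set P) a ↔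
      ∀ v ∈ τ, 0 ≤ toRat x ⬝ᵥ v := by
    intro x
    have hgenset : ((P : Set (Fin n → ℤ)) ∪ (fun g : P => (g : Fin n → ℤ) - a) '' (↑s : Set P)) =
        (pieceZero Δ m : Set (Fin n → ℤ)) ∪ (fun y => y - (a : Fin n → ℤ)) '' (↑s₀ : Set (Fin n → ℤ)) := by
      rw [hP0]
      congr 1
      ext z
      simp only [Set.mem_image, Finset.mem_coe]
      constructor
      · rintro ⟨g, hg, rfl⟩; exact ⟨g, (hs_coe g).1 hg, rfl⟩
      · rintro ⟨y, hy, rfl⟩; exact ⟨⟨y, hpieceP k (hs₀k hy)⟩, (hs_coe _).2 hy, rfl⟩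
    rw [LogChart.blowupChartMonoid, hgenset, ← SetLike.mem_coe, hclos, Set.mem_setOf_eq, htight]
  -- `τ` is regular: dual basis
  obtain ⟨S, hS, hτS⟩ := hreg hτ
  obtain ⟨b, I, -, hbI⟩ := hS.exists_dual_basis
  refine ⟨b, I, ⟨fun x => ?_⟩⟩
  rw [hchart, ← hbI, hτS, forall_mem_hull_dotProduct_nonneg_iff]

end LogBlowup

end Literature.AlgebraicGeometry.Resolution
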